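import Summits.ResolutionOfSingularities.ResolutionOfSingularities.Theorems.HilbertSamuelEliminationSigmaMaxModificationsCorridor3WLadderIsoInsepE2InitialForm
import HarnessLib

/-!
# [OURS · L1 W4.2] E2 chart calculus, brick 3: THE E2 SHAPE LIFTED TO THE REGULAR RING — `h ≡ ĉ·(x² + λ̂y²) (mod 𝔪³)` with `x = Σ ŝᵢyᵢ`,
# `y = Σ t̂ᵢyᵢ` lifting the normal form of the initial form (crux chain w42, cell k2 `T3insep` = `stub_isoInsepTower`;
# `--supports stmt-ResolutionOfSingularities-19249`)

OURS (cell res-hironaka, slot W4.2, seat res-D-pv-042; OWN OBJECT TUO 15:58Z, brick 3 announced 16:23:18Z); NOT a statement of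
[Hironaka2017] nor of [CossartJannsenSaito2020] / [CossartPiltant2008]. AI-drafted, weaker than expert review. PROOF file, def-free, fact-free.

* `exists_e2Shape_of_dirDim` — in the setting of brick 2 (`σ : R ↠ A`, `ker σ = (h)`, `h ∈ 𝔪² ∖ 𝔪³`, residue characteristic two,
  `dirDim A + 2 = d`, `geomDirDim A + 1 = d`) there are `ŝ, t̂ : Fin d → R` with residues linearly independent over `κ(R)`, a unit `ĉ`
  and `λ̂ ∈ R` whose residue is NOT a square, such that **`h − ĉ·((Σ ŝᵢyᵢ)² + λ̂·(Σ t̂ᵢyᵢ)²) ∈ 𝔪_R³`**.  Proof: brick 2 gives the normal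
  form of an initial form `F` of `h` along the residue isomorphism `κ : κ(R) ≅ κ(A)`; lift its data through `κ ∘ residue`; the
  difference of the defining form `P` of `F` (`h = P(y)`) and the lifted form `Q` has residue `0`, so `h − Q(y) ∈ 𝔪³`
  (`mem_pow_succ_iff_of_mem_initialFormsOf` with the zero initial form).  The elements `x := Σ ŝᵢyᵢ`, `y := Σ t̂ᵢyᵢ` extend to a
  regular system of parameters of `R` (residues independent in `𝔪/𝔪²`): this is the algebraic E2 shape `h ≡ ĉ(x² + λ̂y²) mod 𝔪³`
  that the chart lemmas of the NJ/RC dictionary consume.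
-/

noncomputable section

set_option linter.dupNamespace false

open scoped Classical
open IsLocalRing MvPolynomial Module
open Literature.RingTheory.MvPolynomial Literature.RingTheory.HilbertSamuel Literature.AlgebraicGeometry.Resolution
open Summit.ResolutionOfSingularities.ResolutionOfSingularities.Theorems.SigmaMaxModificationsCorridor3

namespace Summit.ResolutionOfSingularities.ResolutionOfSingularities.Cruxes.SigmaMaxModifications.IdeasL1C6

universe u

/-- `MvPolynomial.map` of the E2 normal form. [folklore] -/
theorem map_e2Form {S T : Type u} [CommRing S] [CommRing T] (φ : S →+* T) {n : ℕ} (c lam : S) (s t : Fin n → S) :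
    MvPolynomial.map φ (C c * ((∑ i, C (s i) * X i) ^ 2 + C lam * (∑ i, C (t i) * X i) ^ 2)) =
      C (φ c) * ((∑ i, C (φ (s i)) * X i) ^ 2 + C (φ lam) * (∑ i, C (φ (t i)) * X i) ^ 2) := by
  simp [map_sum]

/-- Evaluation of the E2 normal form. [folklore] -/
theorem eval_e2Form {S : Type u} [CommRing S] {n : ℕ} (c lam : S) (s t y : Fin n → S) :
    eval y (C c * ((∑ i, C (s i) * X i) ^ 2 + C lam * (∑ i, C (t i) * X i) ^ 2)) =
      c * ((∑ i, s i * y i) ^ 2 + lam * (∑ i, t i * y i) ^ 2) := by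
  simp [map_sum, eval_X]

/-- A linear form `Σ vᵢXᵢ` (ring coefficients) is homogeneous of degree `1`. [folklore] -/
theorem isHomogeneous_sum_C_mul_X {S : Type u} [CommRing S] {n : ℕ} (v : Fin n → S) :
    (∑ i, C (v i) * X i : MvPolynomial (Fin n) S).IsHomogeneous 1 := by
  refine IsHomogeneous.sum _ _ _ fun i _ => ?_
  simpa using (isHomogeneous_C (Fin n) (v i)).mul (isHomogeneous_X S i)

/-- The E2 normal form is a quadratic form. [folklore] -/
theorem isHomogeneous_e2Form {S : Type u} [CommRing S] {n : ℕ} (c lam : S) (s t : Fin n → S) :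
    (C c * ((∑ i, C (s i) * X i) ^ 2 + C lam * (∑ i, C (t i) * X i) ^ 2) : MvPolynomial (Fin n) S).IsHomogeneous 2 := by
  have h1 : ((∑ i, C (s i) * X i) ^ 2 : MvPolynomial (Fin n) S).IsHomogeneous 2 := by
    simpa using (isHomogeneous_sum_C_mul_X s).pow 2
  have h2 : ((∑ i, C (t i) * X i) ^ 2 : MvPolynomial (Fin n) S).IsHomogeneous 2 := by
    simpa using (isHomogeneous_sum_C_mul_X t).pow 2
  have h3 : (C lam * (∑ i, C (t i) * X i) ^ 2 : MvPolynomial (Fin n) S).IsHomogeneous 2 := by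
    simpa using (isHomogeneous_C (Fin n) lam).mul h2
  simpa using (isHomogeneous_C (Fin n) c).mul (h1.add h3)

/-- **THE E2 SHAPE IN THE REGULAR RING.** In the setting of brick 2 — `R` regular local with regular parameters `y : Fin d → R`, `σ : R ↠ A`
onto a local ring with `ker σ = (h)`, `h ∈ 𝔪² ∖ 𝔪³`, residue characteristic two, `dirDim A + 2 = d`, `geomDirDim A + 1 = d` — there are
`ŝ, t̂ : Fin d → R` whose residues are linearly independent over `κ(R)`, `ĉ ∉ 𝔪_R` and `λ̂` with `u² − λ̂ ∉ 𝔪_R` for all `u` (the residue of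
`λ̂` is not a square), such that `h − ĉ·((Σ ŝᵢyᵢ)² + λ̂(Σ t̂ᵢyᵢ)²) ∈ 𝔪_R³`. [OURS · L1 W4.2 · k2 · E2 chart calculus, brick 3] [folklore] -/
theorem exists_e2Shape_of_dirDim {R A : Type u} [CommRing R] [IsRegularLocalRing R] [CommRing A] [IsLocalRing A]
    [IsNoetherianRing A] [CharP (ResidueField A) 2] {d : ℕ} (hd : (maximalIdeal R).spanFinrank = d) (y : Fin d → R)
    (hy : Ideal.span (Set.range y) = maximalIdeal R) (σ : R →+* A) (hσ : Function.Surjective σ) {h : R}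
    (hker : RingHom.ker σ = Ideal.span {h}) (h2 : h ∈ maximalIdeal R ^ 2) (h3 : h ∉ maximalIdeal R ^ (2 + 1))
    (he : dirDim A + 2 = d) (hgeom : geomDirDim A + 1 = d) :
    ∃ (s t : Fin d → R) (c lam : R),
      (∀ a b : ResidueField R, (∀ i, a * residue R (s i) + b * residue R (t i) = 0) → a = 0 ∧ b = 0) ∧
      c ∉ maximalIdeal R ∧ (∀ u : R, u ^ 2 - lam ∉ maximalIdeal R) ∧
      h - c * ((∑ i, s i * y i) ^ 2 + lam * (∑ i, t i * y i) ^ 2) ∈ maximalIdeal R ^ 3 := by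
  -- an initial form of `h`
  obtain ⟨F, hF⟩ := (initialFormsOf_nonempty_iff y hy h 2).mpr h2
  obtain ⟨κ, s₁, t₁, c₁, lam₁, hκ, hst, hc₁, hlam₁, hEq⟩ :=
    exists_normalForm_initialForm_of_dirDim hd y hy σ hσ hker h2 h3 hF he hgeom
  -- lift the data through `κ ∘ residue R` (both surjective)
  have hsurj : Function.Surjective (κ.comp (residue R)) := hκ.2.comp Ideal.Quotient.mk_surjective
  choose s hs using fun i => hsurj (s₁ i)
  choose t ht using fun i => hsurj (t₁ i)
  obtain ⟨c, hc⟩ := hsurj c₁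
  obtain ⟨lam, hlam⟩ := hsurj lam₁
  simp only [RingHom.comp_apply] at hs ht hc hlam
  refine ⟨s, t, c, lam, ?_, ?_, ?_, ?_⟩
  · -- independence of the residues (transported along the injective `κ`)
    intro a b hab
    rw [Fintype.linearIndependent_iff] at hst
    have h0 := hst ![κ a, κ b] (by
      ext i
      have := congrArg κ (hab i)
      rw [map_add, map_mul, map_mul, hs, ht, map_zero] at this
      simpa [Fin.sum_univ_two] using this)
    have ha := h0 0
    have hb := h0 1
    simp only [Matrix.cons_val_zero, Matrix.cons_val_one] at ha hb
    exact ⟨hκ.1 (by rw [ha, map_zero]), hκ.1 (by rw [hb, map_zero])⟩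
  · -- `c` is a unit
    intro hcm
    apply hc₁
    rw [← hc, (residue_eq_zero_iff _).mpr hcm, map_zero]
  · -- the residue of `lam` is not a square
    intro u hu
    apply hlam₁ (κ (residue R u))
    have h0 : residue R (u ^ 2 - lam) = 0 := (residue_eq_zero_iff _).mpr hu
    rw [map_sub, sub_eq_zero, map_pow] at h0
    rw [← map_pow, h0, hlam]
  · -- `h - Q(y) ∈ 𝔪³`: the form `P - Q` is an initial form `0` of it
    obtain ⟨P, hPhom, hPeval, hPres⟩ := hF
    set Q : MvPolynomial (Fin d) R := C c * ((∑ i, C (s i) * X i) ^ 2 + C lam * (∑ i, C (t i) * X i) ^ 2) with hQ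
    have hQeval : eval y Q = c * ((∑ i, s i * y i) ^ 2 + lam * (∑ i, t i * y i) ^ 2) := eval_e2Form c lam s t y
    have hQres : MvPolynomial.map κ (MvPolynomial.map (residue R) Q) = MvPolynomial.map κ F := by
      rw [hQ, map_e2Form, map_e2Form, hc, hlam, hEq, linForm_eq_sum_C_mul, linForm_eq_sum_C_mul]
      simp only [hs, ht]
    have hQres' : MvPolynomial.map (residue R) Q = F := map_injective κ hκ.1 hQres
    have hzero : (0 : MvPolynomial (Fin d) (ResidueField R)) ∈ initialFormsOf y (h - eval y Q) 2 :=
      ⟨P - Q, hPhom.sub (isHomogeneous_e2Form c lam s t), by rw [map_sub, hPeval], by rw [map_sub, hPres, hQres', sub_self]⟩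
    rw [← hQeval]
    exact (mem_pow_succ_iff_of_mem_initialFormsOf y hy hzero).mpr (Submodule.zero_mem _)

end Summit.ResolutionOfSingularities.ResolutionOfSingularities.Cruxes.SigmaMaxModifications.IdeasL1C6

end
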